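/-
Copyright (c) 2026 the pub-hodgecm-mathlib formalisation cell (harness21).  Prover seat hodgecm-mathlib-R90-C14-p01 (g0), HCML SLAB R90-TF,
section S3 «§12.7 endoscopic character identities» (base `R90-C12`), (U3-χ) KEY split (B2) (successor S3 dealer R90-C12-plan (g2), RULING S3-R24,
R90 bus 2026-09-05T00:07:10Z; interface probe `R90/S3/K2E3-p17-g10/B1B2Interface.HOMEONLY.lean` d711d29af2f0f708).  2026-09-05.
-/
import Literature.NumberTheory.Automorphic.QuadraticHeckeCharacterCMInfinityType    -- ★ parity computation `infinityTypeChar_infiniteIdeleBaseChange_of_isCMField`, `unitPart`, `circleToUnits`-free kit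
import Literature.NumberTheory.Automorphic.IdeleClassCharacterHecke                  -- ★ `circleToUnits`
import Literature.NumberTheory.GaloisRepresentations.HeckeCharacterAutConj           -- ★ `infPart`, `infPart_principalIdele`
import HarnessLib

/-!
# R90 · S3 — (U3-χ) KEY, brick (B2): the archimedean family `Φ_n = (z ↦ ∏_w (z_w ∕ |z_w|)^{n_w})` — continuity, unitarity, odd restriction, shift law
# (`Theorems/R90S3InfCharFamily.lean`)

Cell `hodgecm-mathlib`, crux H413 (`stmt-HodgeConjecture-24833`), route of record `HCCMUnconditional`; programme R90-TF, section S3 (base `R90-C12`),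
seat R90-C14-p01 (g0).  Helper lane `--supports stmt-HodgeConjecture-24833 --as helper`; THEOREMS ONLY (no definition, no instance, no notation, no `sorry`).

THE FAMILY.  For a CM field `L` and `n : (w ∣ ∞) → ℤ`, `Φ_n := circleToUnits ∘ infinityTypeChar L n : L_∞ˣ →* ℂˣ`, `u ↦ ∏_w (ι_w(u_w) ∕ |ι_w(u_w)|)^{n_w}`
(★ `infinityTypeChar`, Weil's unitary characters of ∞-type `n`).  The four binders `hcont ∕ hunit ∕ hodd ∕ hshift` of the (B1) head
`exists_odd_key_of_infCharFamily` (K2E3-p17's interface of record) hold for THIS family: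
* **`infCharFamily_continuous`** — `Φ_n` is continuous (★ `continuous_infinityTypeChar`);
* **`infCharFamily_norm_eq_one`** — `|Φ_n(z)| = 1` (values in `S¹`);
* **`infCharFamily_odd`** — for `n` with every `n_w` ODD and `a ∈ 𝕀_{L⁺}`: `Φ_n((a_L)_∞) = ε_{L/L⁺}((a_∞, 1))` — an odd power of `y∕|y|` for real `y`
  is `sgn y`, and `ε_{L/L⁺}` has archimedean type `sgn` (★ parity computation `infinityTypeChar_infiniteIdeleBaseChange_of_isCMField` at `m = 1`
  + ★ `coe_quadraticClassCharCM_mk`; `((a_L)_∞ = (a_∞)_L` is definitional);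
* **`infCharFamily_shift`** — the SHIFT LAW at principal idèles: `Φ_{n + 2j}(k_∞) = Φ_n(k_∞) · ∏_w σ_w(k ∕ k̄)^{j_w}` — since
  `(z∕|z|)² = z ∕ z̄` and `σ_w(k̄) = conj(σ_w(k))` (Mathlib `IsCMField.complexEmbedding_complexConj`).
[cite: WeilBNT1967, Ch. VII §3] [cite: Arthur2013, §6.2 Lemma 6.2.2, Remark 2 p. 319]
HONEST LABEL: helper; (U3-χ) is paid only when (B1) + (B2) are ★ and G ED. n plugs `stub_R90_S3_auxGlobaliseChar`; HC_CM is proved only modulo the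
7 printed citations (2 remaining named inputs: hLiu418 = stmt-HodgeConjecture-24832, h413 = stmt-HodgeConjecture-24833) until rung 0 closes; count-neutral.
-/

set_option autoImplicit false
set_option linter.dupNamespace false

noncomputable section

namespace Summit.HodgeConjecture.HodgeConjecture.R90.S3

open NumberField NumberField.InfinitePlace NumberField.InfinitePlace.Completion IsDedekindDomain
open Literature.NumberTheory.GaloisRepresentations Literature.NumberTheory.GaloisRepresentations.HeckeCharacter
open Literature.NumberTheory.Automorphic Literature.Analysis.Complex
open scoped ComplexConjugate

variable (L : Type) [Field L] [NumberField L] [IsCMField L]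

omit [IsCMField L] in
/-- **(B2, hcont)** `Φ_n = circleToUnits ∘ infinityTypeChar L n` is continuous. [cite: WeilBNT1967, Ch. VII §3] -/
theorem infCharFamily_continuous (n : InfinitePlace L → ℤ) :
    Continuous ((circleToUnits : Circle →ₜ* ℂˣ).toMonoidHom.comp (infinityTypeChar L n)) :=
  circleToUnits.continuous.comp (continuous_infinityTypeChar L n)

omit [IsCMField L] in
/-- **(B2, hunit)** `|Φ_n(z)| = 1`. [cite: WeilBNT1967, Ch. VII §3] -/
theorem infCharFamily_norm_eq_one (n : InfinitePlace L → ℤ) (z : (InfiniteAdeleRing L)ˣ) :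
    ‖(((circleToUnits : Circle →ₜ* ℂˣ).toMonoidHom.comp (infinityTypeChar L n) z : ℂˣ) : ℂ)‖ = 1 := by
  rw [MonoidHom.comp_apply]
  exact Circle.norm_coe _

/-- **(B2, hodd) — ODD EXPONENTS RESTRICT TO `ε_{L/L⁺}` ON BASE-CHANGED IDÈLES**: if every `n_w` is odd then for every idèle `a` of `L⁺`,
`Φ_n((a_L)_∞) = ε_{L/L⁺}((a_∞, 1))` (both are `∏_v sgn(a_v)`). [cite: WeilBNT1967, Ch. VII §3] -/
theorem infCharFamily_odd (n : InfinitePlace L → ℤ) (hn : ∀ w, Odd (n w)) (a : ideleGroup ↥(maximalRealSubfield L)) :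
    (circleToUnits : Circle →ₜ* ℂˣ).toMonoidHom.comp (infinityTypeChar L n)
        (infPart L (AdeleRing.ideleBaseChange (↥(maximalRealSubfield L)) L a)) =
      quadraticHeckeCharCM L (infiniteIdeles ↥(maximalRealSubfield L) (infPart ↥(maximalRealSubfield L) a)) := by
  have hpar : ∀ w, n w ≡ 1 [ZMOD 2] := fun w => by
    obtain ⟨k, hk⟩ := hn w
    exact (Int.modEq_iff_dvd).2 ⟨-k, by rw [hk]; ring⟩
  have hinf : infPart L (AdeleRing.ideleBaseChange (↥(maximalRealSubfield L)) L a) =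
      infiniteIdeleBaseChange (↥(maximalRealSubfield L)) L (infPart ↥(maximalRealSubfield L) a) := Units.ext rfl
  apply Units.ext
  rw [MonoidHom.comp_apply, hinf, infinityTypeChar_infiniteIdeleBaseChange_of_isCMField L 1 n hpar, zpow_one]
  change ((quadraticClassCharCM L _ : Circle) : ℂ) = _
  rw [infUnitsToClass_apply, coe_quadraticClassCharCM_mk]

/-- **(B2, hshift) — THE SHIFT LAW AT PRINCIPAL IDÈLES**: `Φ_{n + 2j}(k_∞) = Φ_n(k_∞) · ∏_w σ_w(k ∕ k̄)^{j_w}` for `k ∈ Lˣ`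
(`(z∕|z|)² = z∕z̄`, `σ_w(k̄) = \overline{σ_w(k)}`). [cite: WeilBNT1967, Ch. VII §3] -/
theorem infCharFamily_shift (n j : InfinitePlace L → ℤ) (k : Lˣ) :
    (((circleToUnits : Circle →ₜ* ℂˣ).toMonoidHom.comp (infinityTypeChar L (n + 2 • j))
        (infPart L (Literature.NumberTheory.GaloisRepresentations.principalIdele L k)) : ℂˣ) : ℂ) =
      (circleToUnits : Circle →ₜ* ℂˣ).toMonoidHom.comp (infinityTypeChar L n) (infPart L (Literature.NumberTheory.GaloisRepresentations.principalIdele L k)) *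
        ∏ w : InfinitePlace L, (w.embedding ((k : L) * ((IsCMField.complexConj L) (k : L))⁻¹)) ^ (j w) := by
  -- the `w`-component of `k_∞` read in `ℂ` is `σ_w(k)`
  have hcoord : ∀ w : InfinitePlace L,
      ((InfiniteAdeleRing.infLocalUnits L w (infPart L (Literature.NumberTheory.GaloisRepresentations.principalIdele L k)) : ℂˣ) : ℂ) = w.embedding (k : L) := by
    intro w
    rw [InfiniteAdeleRing.coe_infLocalUnits, infPart_principalIdele, val_globalToInfiniteUnits]
    change Completion.extensionEmbedding w (((WithAbs.equiv w.1).symm (k : L) : WithAbs w.1) : w.Completion) = _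
    rw [Completion.extensionEmbedding_coe, RingEquiv.apply_symm_apply]
  -- one place: `(c∕|c|)^{n + 2j} = (c∕|c|)^n · (c∕c̄)^j`
  have hplace : ∀ w : InfinitePlace L,
      ((unitPart (InfiniteAdeleRing.infLocalUnits L w (infPart L (Literature.NumberTheory.GaloisRepresentations.principalIdele L k))) : Circle) : ℂ) ^
          (n w + 2 * j w) =
        ((unitPart (InfiniteAdeleRing.infLocalUnits L w (infPart L (Literature.NumberTheory.GaloisRepresentations.principalIdele L k))) : Circle) : ℂ) ^
            (n w) * (w.embedding ((k : L) * ((IsCMField.complexConj L) (k : L))⁻¹)) ^ (j w) := by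
    intro w
    set c : ℂ := w.embedding (k : L) with hc
    have hc0 : c ≠ 0 := by
      rw [hc]; exact (map_ne_zero _).2 (Units.ne_zero k)
    have hu : ((unitPart (InfiniteAdeleRing.infLocalUnits L w
        (infPart L (Literature.NumberTheory.GaloisRepresentations.principalIdele L k))) : Circle) : ℂ) = c / (‖c‖ : ℂ) := by
      rw [coe_unitPart, hcoord]
    have hu0 : (c / (‖c‖ : ℂ)) ≠ 0 := div_ne_zero hc0 (by exact_mod_cast (norm_ne_zero_iff.2 hc0))
    have hsq : (c / (‖c‖ : ℂ)) ^ (2 : ℤ) = c * (conj c)⁻¹ := by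
      have hcc : conj c ≠ 0 := (map_ne_zero _).2 hc0
      have hnorm : ((‖c‖ : ℂ)) ^ 2 = c * conj c := by
        rw [← Complex.ofReal_pow, ← Complex.normSq_eq_norm_sq, Complex.mul_conj]
      rw [zpow_two, div_mul_div_comm, ← pow_two, ← pow_two, hnorm]
      field_simp
    have hemb : w.embedding ((k : L) * ((IsCMField.complexConj L) (k : L))⁻¹) = c * (conj c)⁻¹ := by
      rw [map_mul, map_inv₀, IsCMField.complexEmbedding_complexConj, ← hc]
    rw [hu, zpow_add₀ hu0, zpow_mul, hsq, hemb]
  -- unfold the family at the principal idèle and multiply the places together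
  have happ : ∀ (m : InfinitePlace L → ℤ) (x : (InfiniteAdeleRing L)ˣ),
      ((((circleToUnits : Circle →ₜ* ℂˣ).toMonoidHom.comp (infinityTypeChar L m)) x : ℂˣ) : ℂ) =
        ((infinityTypeChar L m x : Circle) : ℂ) := fun _ _ => rfl
  have hexp : ∀ w, (n + 2 • j) w = n w + 2 * j w := fun w => by simp
  rw [happ, happ, infinityTypeChar_apply, infinityTypeChar_apply, ← Circle.coeHom_apply, ← Circle.coeHom_apply, map_prod, map_prod,
    ← Finset.prod_mul_distrib]
  exact Finset.prod_congr rfl fun w _ => by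
    rw [Circle.coeHom_apply, Circle.coeHom_apply, Circle.coe_zpow, Circle.coe_zpow, hexp w, hplace w]

end Summit.HodgeConjecture.HodgeConjecture.R90.S3

end
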